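import Summits.CriticalPhenomena.PercolationContinuityZ3.Theorems.PercAnnulusCrossingIICNearPoint
import HarnessLib

/-!
# Visits of Kesten's IIC to far balls, the lower step: from a visited ball the IIC reaches a nearby ball at the price of that ball's arm (lane RSW3, p1 gen 25)

builds on p205010 (kernel theorem, internal audit signed; external expert review pending) — NOT used in this file (every `d`, `p`; Harris'
inequality, the robust glued annulus `CU⁺_l`, deterministic path surgery, translation invariance, the IIC limit property).

RSW3 lane (LANE 3 `prim-rsw3`), seat `prim-rsw3-p1` (gen 25).  Helper file (`--supports stmt-CriticalPhenomena-4575`); no definitions,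
no sorries.  Memo `run/shared/lean/prim/rsw3/P1-QM.md` §38.

The tree lower step of the minimal spanning tree WITH RADII (`…IICVisitsSpanningTree`): `…IICNearPoint` attaches a ball to the ARM OF
THE ROOT (annulus centred at the root); here a ball is attached to a VISITED PARENT BALL (annulus centred at the parent).  Frame of the
parent: the annulus `R(a, la)` is centred at `0`, the parent target `P` and the new target `B` lie in `Λ(a−1)`, the root is `y ∉ Λ(la−1)`
and all connections are inside a region `Z ⊇ Λ(la + a)`.  On `{y ↔ P in Z}` the path from the far root enters `Λ(a−1)`, so `y` is joined to
`∂ⁱⁿΛ(a)` off `Λ(a−1)`; on the link event `{B ↔ ∂ⁱⁿΛ(la+a) in Λ(la+a)}` (probability `≥ π(la+a)/π(|B|-scale)`, Harris-independent lower bound)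
the endpoint `t' ∉ Λ(la−1)` of the link is joined to `∂ⁱⁿΛ(a)` off `Λ(a−1)`; both outer connections cross `R(a,la)` and the robust glued
annulus `U(a,la)` (cost `c_U` on the increasing intersection) joins them: `y ↔ t' ↔ B` inside `Z`.

* `openConnIn_of_annulusUniq_of_farRoot_of_link` — the deterministic glueing;
* **`real_inter_parentHit_inter_ballHit_ge`** — every `d`, `p`; `CU⁺_l(c_U)`, `l ≥ 2`, `c_U ≥ 0`; `a ≥ 1`, `P, B ⊆ Λ(a−1)`, `y ∉ Λ(la−1)`,
  `Λ(la+a) ⊆ Z`: for every increasing measurable `E`,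
  **`c_U · P(∃ b ∈ B, ∃ t ∈ ∂ⁱⁿΛ(la+a), b ↔ t in Λ(la+a)) · P(E ∩ {∃ q ∈ P, y ↔ q in Z}) ≤ P(E ∩ {∃ q ∈ P, y ↔ q in Z} ∩ {∃ b ∈ B, y ↔ b in Z})`**;
* **`iicMeasure_real_inter_parentHit_inter_ballHit_ge`** — the IIC form in the frame of the root (every `d ≥ 1`, `p > 0`): parent centre `z`
  with `z ∉ Λ(la−1)`, `P, B ⊆ Λ(a−1)`, `‖z‖ + la + a ≤ R`; for every finite measure `ν` with Kesten's IIC limit property and every increasing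
  cylinder event `E`:
  **`c_U · P(Λ-link of B at scale la+a) · ν(E ∩ {∃ q ∈ z+P, 0 ↔ q in Λ(R)}) ≤ ν(E ∩ {∃ q ∈ z+P, 0 ↔ q in Λ(R)} ∩ {∃ b ∈ z+B, 0 ↔ b in Λ(R)})`**
  — GIVEN THAT THE IIC VISITS THE PARENT BALL (and any increasing local information), IT VISITS A BALL NEAR THE PARENT AT THE PRICE OF THAT
  BALL'S ARM TO THE PARENT'S SCALE.
The `p_c` constants (`≥ c·π(dist)/π(m)`) and the induction along a spanning tree are in `…IICVisitsSpanningTree`.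
References: T. E. Harris, Proc. Camb. Phil. Soc. 56 (1960) Lemma 4.1; H. Kesten, PTRF 73 (1986) Thm. (8), §2; G. Grimmett, *Percolation* (1999) §1.6, §2.2.
-/

noncomputable section

namespace Summit.CriticalPhenomena.PercolationContinuityZ3.Theorems.Crossing

open MeasureTheory Filter Topology Literature.Probability.Percolation Literature.Probability.LatticeModels
open Literature.Probability.Percolation.DCT16
open Summit.CriticalPhenomena.PercolationContinuityZ3.Theorems.SurfaceTension

variable {d : ℕ}

/-! ## §1 Deterministic glueing around the parent -/

/-- **A LINKED BALL NEAR A VISITED SITE IS VISITED** (deterministic; lattice configuration; `1 ≤ a`, `2 ≤ l`, `Λ(la+a) ⊆ Z`).  On the glued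
annulus `U(a, la)`: if the far root `y ∉ Λ(la−1)` is joined inside `Z` to a site `q ∈ Λ(a−1)`, and a site `b ∈ Λ(a−1)` is joined inside
`Λ(la+a)` to some `t' ∈ ∂ⁱⁿΛ(la+a)`, then **`y ↔ b in Z`** (both paths cross `R(a,la)`; `U` glues the crossings off `Λ(a−1)`).
[cite: Kesten1986, §2] -/
theorem openConnIn_of_annulusUniq_of_farRoot_of_link {a l : ℕ} (ha : 1 ≤ a) (hl : 2 ≤ l) {ω : BondConfig (Site d)}
    (hω : ω ⊆ (zdGraph d).edgeSet)
    (hU : ω ∈ {ω : BondConfig (Site d) | ∀ t ∈ innerBoundary (zdGraph d) (box d a), ∀ s ∈ innerBoundary (zdGraph d) (box d (l * a)),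
      ∀ t' ∈ innerBoundary (zdGraph d) (box d a), ∀ s' ∈ innerBoundary (zdGraph d) (box d (l * a)),
      ω ∈ openConnIn (↑((box d (l * a) \ box d a) ∪ innerBoundary (zdGraph d) (box d a)) : Set (Site d)) t s →
      ω ∈ openConnIn (↑((box d (l * a) \ box d a) ∪ innerBoundary (zdGraph d) (box d a)) : Set (Site d)) t' s' →
      ω ∈ openConnIn (↑((box d (l * a) \ box d a) ∪ innerBoundary (zdGraph d) (box d a)) : Set (Site d)) s s'})
    {Z : Set (Site d)} (hZ : (↑(box d (l * a + a)) : Set (Site d)) ⊆ Z) {y q b t' : Site d} (hy : y ∉ box d (l * a - 1))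
    (hq : q ∈ box d (a - 1)) (hb : b ∈ box d (a - 1)) (ht' : t' ∈ innerBoundary (zdGraph d) (box d (l * a + a)))
    (hyq : ω ∈ openConnIn Z y q) (hbt' : ω ∈ openConnIn (↑(box d (l * a + a)) : Set (Site d)) b t') :
    ω ∈ openConnIn Z y b := by
  have hla : a < l * a := by nlinarith
  have hya : y ∉ box d (a - 1) := fun h => hy (box_mono d (by omega) h)
  have ht'la : t' ∉ box d (l * a + a - 1) := notMem_box_of_mem_innerBoundary_box (by omega) ht'
  have ht'b : t' ∉ box d (l * a - 1) := fun h => ht'la (box_mono d (by omega) h)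
  have ht'a : t' ∉ box d (a - 1) := fun h => ht'la (box_mono d (by omega) h)
  have hZla : (↑(box d (l * a)) : Set (Site d)) ⊆ Z := fun z hz => hZ (Finset.mem_coe.2 (box_mono d (by omega) (Finset.mem_coe.1 hz)))
  -- the root is joined to `∂ⁱⁿΛ(a)` off `Λ(a−1)`
  have hqy : ω ∈ openConnIn Z q y := by rw [openConnIn_comm]; exact hyq
  obtain ⟨t, ht, hyt⟩ := exists_innerBoundary_openConnIn_sdiff_of_openConnIn_of_mem ha hω hq hya hqy
  -- the endpoint of the link is joined to `∂ⁱⁿΛ(a)` off `Λ(a−1)`, inside `Z`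
  have hbt'Z : ω ∈ openConnIn Z b t' := openConnIn_mono hZ b t' hbt'
  obtain ⟨t₂, ht₂, ht't₂⟩ := exists_innerBoundary_openConnIn_sdiff_of_openConnIn_of_mem ha hω hb ht'a hbt'Z
  -- glue the two outer connections through `U(a, la)`
  have hyt' : ω ∈ openConnIn (Z \ ↑(box d (a - 1))) y t' :=
    openConnIn_sdiff_of_annulusUniq_of_outerConn ha hla hω hU hZla hy ht'b ht ht₂ hyt ht't₂
  have ht'bZ : ω ∈ openConnIn Z t' b := by rw [openConnIn_comm]; exact hbt'Z
  exact mem_openConnIn_of_pathIn (((pathIn_of_mem_openConnIn hyt').mono fun z hz => hz.1).trans (pathIn_of_mem_openConnIn ht'bZ))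

/-! ## §2 Under `P_p`, in the frame of the parent: Harris for the link, `CU⁺_l` for the glueing -/

/-- **FROM A VISITED BALL THE CLUSTER OF A FAR ROOT REACHES A NEARBY BALL AT THE PRICE OF THAT BALL'S ARM, ON EVERY INCREASING EVENT**
(every `d`, `p`; `CU⁺_l(c_U)`, `l ≥ 2`, `c_U ≥ 0`; `a ≥ 1`; `P, B ⊆ Λ(a−1)`; `y ∉ Λ(la−1)`; `Λ(la+a) ⊆ Z`): for every increasing measurable `E`,
**`c_U · P_p(∃ b ∈ B, ∃ t ∈ ∂ⁱⁿΛ(la+a), b ↔ t in Λ(la+a)) · P_p(E ∩ {∃ q ∈ P, y ↔ q in Z}) ≤ P_p(E ∩ {∃ q ∈ P, y ↔ q in Z} ∩ {∃ b ∈ B, y ↔ b in Z})`**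
(Harris for the increasing events `E ∩ {y ↔ P in Z}` and the link; robust uniqueness on their intersection; §1).
[cite: Harris1960, Lemma 4.1] [cite: Kesten1986, §2] -/
theorem real_inter_parentHit_inter_ballHit_ge (p : unitInterval) {l : ℕ} (hl : 2 ≤ l) {cU : ℝ} (hcU : 0 ≤ cU)
    (hCU : ∀ a : ℕ, 1 ≤ a → ∀ E : Set (BondConfig (Site d)), IsUpperSet E → MeasurableSet E →
      cU * (bondPercolation (zdGraph d) p).real E ≤ (bondPercolation (zdGraph d) p).real (E ∩
        {ω : BondConfig (Site d) | ∀ t ∈ innerBoundary (zdGraph d) (box d a), ∀ s ∈ innerBoundary (zdGraph d) (box d (l * a)),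
        ∀ t' ∈ innerBoundary (zdGraph d) (box d a), ∀ s' ∈ innerBoundary (zdGraph d) (box d (l * a)),
        ω ∈ openConnIn (↑((box d (l * a) \ box d a) ∪ innerBoundary (zdGraph d) (box d a)) : Set (Site d)) t s →
        ω ∈ openConnIn (↑((box d (l * a) \ box d a) ∪ innerBoundary (zdGraph d) (box d a)) : Set (Site d)) t' s' →
        ω ∈ openConnIn (↑((box d (l * a) \ box d a) ∪ innerBoundary (zdGraph d) (box d a)) : Set (Site d)) s s'}))
    {E : Set (BondConfig (Site d))} (hE : IsUpperSet E) (hEm : MeasurableSet E) {a : ℕ} (ha : 1 ≤ a) (y : Site d)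
    (hy : y ∉ box d (l * a - 1)) (P B : Finset (Site d)) (hP : P ⊆ box d (a - 1)) (hB : B ⊆ box d (a - 1))
    {Z : Set (Site d)} (hZ : (↑(box d (l * a + a)) : Set (Site d)) ⊆ Z) :
    cU * (bondPercolation (zdGraph d) p).real {ω : BondConfig (Site d) | ∃ b ∈ B,
          ∃ t ∈ innerBoundary (zdGraph d) (box d (l * a + a)), ω ∈ openConnIn (↑(box d (l * a + a)) : Set (Site d)) b t} *
        (bondPercolation (zdGraph d) p).real (E ∩ {ω | ∃ q ∈ P, ω ∈ openConnIn Z y q}) ≤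
      (bondPercolation (zdGraph d) p).real
        (E ∩ {ω | ∃ q ∈ P, ω ∈ openConnIn Z y q} ∩ {ω | ∃ b ∈ B, ω ∈ openConnIn Z y b}) := by
  classical
  set μ := bondPercolation (zdGraph d) p with hμ
  set V : Set (BondConfig (Site d)) := {ω : BondConfig (Site d) | ∃ b ∈ B,
      ∃ t ∈ innerBoundary (zdGraph d) (box d (l * a + a)), ω ∈ openConnIn (↑(box d (l * a + a)) : Set (Site d)) b t} with hV
  set H : Set (BondConfig (Site d)) := {ω | ∃ q ∈ P, ω ∈ openConnIn Z y q} with hH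
  have hVeq : V = ⋃ b ∈ B, ⋃ t ∈ innerBoundary (zdGraph d) (box d (l * a + a)),
      (openConnIn (↑(box d (l * a + a)) : Set (Site d)) b t : Set (BondConfig (Site d))) := by
    ext ω; simp only [hV, Set.mem_setOf_eq, Set.mem_iUnion, exists_prop]
  have hVu : IsUpperSet V := by
    rw [hVeq]; exact isUpperSet_iUnion₂ fun b _ => isUpperSet_iUnion₂ fun t _ => isUpperSet_openConnIn _ b t
  have hVm : MeasurableSet V := by
    rw [hVeq]
    exact Finset.measurableSet_biUnion _ fun b _ => Finset.measurableSet_biUnion _ fun t _ => measurableSet_openConnIn_of_countable _ b t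
  have hHeq : H = ⋃ q ∈ P, (openConnIn Z y q : Set (BondConfig (Site d))) := by
    ext ω; simp only [hH, Set.mem_setOf_eq, Set.mem_iUnion, exists_prop]
  have hHu : IsUpperSet H := by rw [hHeq]; exact isUpperSet_iUnion₂ fun q _ => isUpperSet_openConnIn _ y q
  have hHm : MeasurableSet H := by rw [hHeq]; exact Finset.measurableSet_biUnion _ fun q _ => measurableSet_openConnIn_of_countable _ y q
  set F : Set (BondConfig (Site d)) := E ∩ H ∩ V with hF
  have hFup : IsUpperSet F := (hE.inter hHu).inter hVu
  have hFm : MeasurableSet F := (hEm.inter hHm).inter hVm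
  have hHarris : μ.real (E ∩ H) * μ.real V ≤ μ.real F := harris_fkg_holds (zdGraph d) p (hE.inter hHu) hVu (hEm.inter hHm) hVm
  have hCUF := hCU a ha F hFup hFm
  have hmono : μ.real (F ∩ {ω : BondConfig (Site d) | ∀ t ∈ innerBoundary (zdGraph d) (box d a),
        ∀ s ∈ innerBoundary (zdGraph d) (box d (l * a)), ∀ t' ∈ innerBoundary (zdGraph d) (box d a), ∀ s' ∈ innerBoundary (zdGraph d) (box d (l * a)),
        ω ∈ openConnIn (↑((box d (l * a) \ box d a) ∪ innerBoundary (zdGraph d) (box d a)) : Set (Site d)) t s →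
        ω ∈ openConnIn (↑((box d (l * a) \ box d a) ∪ innerBoundary (zdGraph d) (box d a)) : Set (Site d)) t' s' →
        ω ∈ openConnIn (↑((box d (l * a) \ box d a) ∪ innerBoundary (zdGraph d) (box d a)) : Set (Site d)) s s'}) ≤
      μ.real (E ∩ H ∩ {ω | ∃ b ∈ B, ω ∈ openConnIn Z y b}) := by
    refine real_mono_of_forall_subset_edgeSet (zdGraph d) p fun ω hω h => ?_
    obtain ⟨⟨⟨hωE, q, hq, hyq⟩, b, hb, t', ht', hbt'⟩, hωU⟩ := h
    exact ⟨⟨hωE, q, hq, hyq⟩, b, hb,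
      openConnIn_of_annulusUniq_of_farRoot_of_link ha hl hω hωU hZ hy (hP hq) (hB hb) ht' hyq hbt'⟩
  calc cU * μ.real V * μ.real (E ∩ H) = cU * (μ.real (E ∩ H) * μ.real V) := by ring
    _ ≤ cU * μ.real F := mul_le_mul_of_nonneg_left hHarris hcU
    _ ≤ _ := hCUF
    _ ≤ _ := hmono

/-! ## §3 Under the IIC, in the frame of the root -/

/-- **FROM A VISITED BALL THE IIC REACHES A NEARBY BALL AT THE PRICE OF THAT BALL'S ARM, on increasing cylinders** (every `d ≥ 1`, `p > 0`;
`CU⁺_l(c_U)`, `l ≥ 2`, `c_U ≥ 0`; `a ≥ 1`; parent centre `z ∉ Λ(la−1)`; `P, B ⊆ Λ(a−1)`; `‖z‖_∞ + la + a ≤ R`): for every finite measure `ν`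
with Kesten's IIC limit property and every increasing cylinder event `E`,
**`c_U · P_p(∃ b ∈ B, ∃ t ∈ ∂ⁱⁿΛ(la+a), b ↔ t in Λ(la+a)) · ν(E ∩ {∃ q ∈ z + P, 0 ↔ q in Λ(R)})`
  `≤ ν(E ∩ {∃ q ∈ z + P, 0 ↔ q in Λ(R)} ∩ {∃ b ∈ z + B, 0 ↔ b in Λ(R)})`** (translation by `−z`, §2 at every `N` for the increasing event
`(E − z) ∩ A_N(−z)`, divided by `π(N)`, `N → ∞`). [cite: Kesten1986, Thm. (8)] [cite: Harris1960, Lemma 4.1] -/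
theorem iicMeasure_real_inter_parentHit_inter_ballHit_ge (hd : 1 ≤ d) (p : unitInterval) (hp : 0 < (p : ℝ)) {l : ℕ} (hl : 2 ≤ l)
    {cU : ℝ} (hcU : 0 ≤ cU)
    (hCU : ∀ a : ℕ, 1 ≤ a → ∀ E : Set (BondConfig (Site d)), IsUpperSet E → MeasurableSet E →
      cU * (bondPercolation (zdGraph d) p).real E ≤ (bondPercolation (zdGraph d) p).real (E ∩
        {ω : BondConfig (Site d) | ∀ t ∈ innerBoundary (zdGraph d) (box d a), ∀ s ∈ innerBoundary (zdGraph d) (box d (l * a)),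
        ∀ t' ∈ innerBoundary (zdGraph d) (box d a), ∀ s' ∈ innerBoundary (zdGraph d) (box d (l * a)),
        ω ∈ openConnIn (↑((box d (l * a) \ box d a) ∪ innerBoundary (zdGraph d) (box d a)) : Set (Site d)) t s →
        ω ∈ openConnIn (↑((box d (l * a) \ box d a) ∪ innerBoundary (zdGraph d) (box d a)) : Set (Site d)) t' s' →
        ω ∈ openConnIn (↑((box d (l * a) \ box d a) ∪ innerBoundary (zdGraph d) (box d a)) : Set (Site d)) s s'}))
    {ν : Measure (BondConfig (Site d))} [IsFiniteMeasure ν]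
    (hν : ∀ (F : Finset (Sym2 (Site d))) (E : Set (BondConfig (Site d))), MeasurableSet E → DeterminedBy E ↑F →
      Tendsto (fun n : ℕ => (bondPercolation (zdGraph d) p).real (E ∩ siteToBoundary d n) / oneArmProb d p n)
        atTop (𝓝 (ν.real E)))
    {E : Set (BondConfig (Site d))} (hE : IsUpperSet E) (hEl : IsLocalEvent E) {a : ℕ} (ha : 1 ≤ a) (z : Site d)
    (hz : z ∉ box d (l * a - 1)) (P B : Finset (Site d)) (hP : P ⊆ box d (a - 1)) (hB : B ⊆ box d (a - 1)) {R : ℕ}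
    (hR : Site.supNorm z + (l * a + a) ≤ R) :
    cU * (bondPercolation (zdGraph d) p).real {ω : BondConfig (Site d) | ∃ b ∈ B,
          ∃ t ∈ innerBoundary (zdGraph d) (box d (l * a + a)), ω ∈ openConnIn (↑(box d (l * a + a)) : Set (Site d)) b t} *
        ν.real (E ∩ {ω | ∃ q ∈ P.image (· + z), ω ∈ openConnIn (↑(box d R) : Set (Site d)) (0 : Site d) q}) ≤
      ν.real (E ∩ {ω | ∃ q ∈ P.image (· + z), ω ∈ openConnIn (↑(box d R) : Set (Site d)) (0 : Site d) q} ∩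
        {ω | ∃ b ∈ B.image (· + z), ω ∈ openConnIn (↑(box d R) : Set (Site d)) (0 : Site d) b}) := by
  classical
  set μ := bondPercolation (zdGraph d) p with hμ
  have hπ : ∀ n, 0 < oneArmProb d p n := oneArmProb_pos hd p hp
  have hEm : MeasurableSet E := measurableSet_of_isLocalEvent_holds hEl
  obtain ⟨FE, hFE⟩ := hEl
  set PV : ℝ := μ.real {ω : BondConfig (Site d) | ∃ b ∈ B,
      ∃ t ∈ innerBoundary (zdGraph d) (box d (l * a + a)), ω ∈ openConnIn (↑(box d (l * a + a)) : Set (Site d)) b t} with hPV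
  -- the box-constrained visit events of the root frame, as `{∃ x₁ ∈ {0}, ∃ q ∈ X, x₁ ↔ q in Λ(R)}`
  set Hof : Finset (Site d) → Set (BondConfig (Site d)) := fun X =>
    {ω | ∃ x₁ ∈ ({0} : Finset (Site d)), ∃ q ∈ X, ω ∈ openConnIn (↑(box d R) : Set (Site d)) x₁ q} with hHof
  have hHof_eq : ∀ X : Finset (Site d), Hof X = {ω | ∃ q ∈ X, ω ∈ openConnIn (↑(box d R) : Set (Site d)) (0 : Site d) q} := by
    intro X; ext ω; simp only [hHof, Set.mem_setOf_eq, Finset.mem_singleton, exists_eq_left]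
  have hdet : ∀ X : Finset (Site d), DeterminedBy (Hof X) (↑(box d R).sym2 : Set (Sym2 (Site d))) := by
    intro X
    have h : Hof X = ⋃ x₁ ∈ ({0} : Finset (Site d)), ⋃ q ∈ X, (openConnIn (↑(box d R) : Set (Site d)) x₁ q : Set (BondConfig (Site d))) := by
      ext ω; simp only [hHof, Set.mem_setOf_eq, Set.mem_iUnion, exists_prop]
    rw [h]
    exact DeterminedBy.iUnion fun x₁ => DeterminedBy.iUnion fun _ => DeterminedBy.iUnion fun q => DeterminedBy.iUnion fun _ =>
      determinedBy_openConnIn (↑(box d R)) x₁ q (K := ↑(box d R).sym2) (by rw [Finset.coe_sym2])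
  have hup : ∀ X : Finset (Site d), IsUpperSet (Hof X) := by
    intro X ω ω' hle ⟨x₁, hx₁, q, hq, h⟩; exact ⟨x₁, hx₁, q, hq, isUpperSet_openConnIn _ _ _ hle h⟩
  -- translation of the three pieces
  have hpre : ∀ X : Finset (Site d), BondConfig.relabel (sym2Equiv (Site.shift z)) ⁻¹' Hof (X.image (· + z)) =
      {ω | ∃ q ∈ X, ω ∈ openConnIn (↑((box d R).image (· - z)) : Set (Site d)) (-z) q} := by
    intro X
    rw [hHof, preimage_shift_exists_openConnIn, Finset.image_singleton, zero_sub, image_add_image_sub]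
    ext ω; simp only [Set.mem_setOf_eq, Finset.mem_singleton, exists_eq_left]
  have harm : ∀ N : ℕ, BondConfig.relabel (sym2Equiv (Site.shift z)) ⁻¹' siteToBoundary d N = DCT16.armEvent (-z) N := by
    intro N; rw [← preimage_shift_siteToBoundary (-z) N, neg_neg]
  set Ez : Set (BondConfig (Site d)) := BondConfig.relabel (sym2Equiv (Site.shift z)) ⁻¹' E with hEz
  have hEzu : IsUpperSet Ez := hE.preimage_relabel _
  have hEzm : MeasurableSet Ez := hEm.preimage (BondConfig.relabel _).measurable
  have hAu : ∀ N, IsUpperSet (DCT16.armEvent (-z) N) := fun N => by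
    rw [← harm N]; exact (isUpperSet_siteToBoundary d N).preimage_relabel _
  have hAm : ∀ N, MeasurableSet (DCT16.armEvent (-z) N) := fun N => by
    rw [← harm N]; exact (measurableSet_siteToBoundary d N).preimage (BondConfig.relabel _).measurable
  have hy : -z ∉ box d (l * a - 1) := fun h => hz (by rwa [mem_box_iff_supNorm_le, Site.supNorm_neg, ← mem_box_iff_supNorm_le] at h)
  have hZ : (↑(box d (l * a + a)) : Set (Site d)) ⊆ ↑((box d R).image (· - z)) := by
    intro w hw
    refine Finset.mem_coe.2 (Finset.mem_image.2 ⟨w + z, ?_, add_sub_cancel_right w z⟩)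
    have h1 := mem_box_iff_supNorm_le.1 (Finset.mem_coe.1 hw)
    have h2 := Site.supNorm_add_le w z
    exact mem_box_iff_supNorm_le.2 (by omega)
  -- the finite inequality at every `N`
  have hstep : ∀ N : ℕ, cU * PV * μ.real (E ∩ Hof (P.image (· + z)) ∩ siteToBoundary d N) ≤
      μ.real (E ∩ Hof (P.image (· + z)) ∩ Hof (B.image (· + z)) ∩ siteToBoundary d N) := by
    intro N
    have htransL : μ.real (E ∩ Hof (P.image (· + z)) ∩ siteToBoundary d N) =
        μ.real ((Ez ∩ DCT16.armEvent (-z) N) ∩ {ω | ∃ q ∈ P, ω ∈ openConnIn (↑((box d R).image (· - z)) : Set (Site d)) (-z) q}) := by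
      rw [← bondPercolation_real_preimage_shift z p, Set.preimage_inter, Set.preimage_inter, hpre, harm]
      congr 1; ext ω; simp only [Set.mem_inter_iff, hEz, Set.mem_preimage]; tauto
    have htransR : μ.real (E ∩ Hof (P.image (· + z)) ∩ Hof (B.image (· + z)) ∩ siteToBoundary d N) =
        μ.real ((Ez ∩ DCT16.armEvent (-z) N) ∩ {ω | ∃ q ∈ P, ω ∈ openConnIn (↑((box d R).image (· - z)) : Set (Site d)) (-z) q} ∩
          {ω | ∃ b ∈ B, ω ∈ openConnIn (↑((box d R).image (· - z)) : Set (Site d)) (-z) b}) := by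
      rw [← bondPercolation_real_preimage_shift z p, Set.preimage_inter, Set.preimage_inter, Set.preimage_inter, hpre, hpre, harm]
      congr 1; ext ω; simp only [Set.mem_inter_iff, hEz, Set.mem_preimage]; tauto
    rw [htransL, htransR]
    exact real_inter_parentHit_inter_ballHit_ge p hl hcU hCU ((hEzu).inter (hAu N)) (hEzm.inter (hAm N)) ha (-z) hy P B hP hB hZ
  -- divide by `π(N)` and pass to the limit
  have hloc₁ : IsLocalEvent (E ∩ Hof (P.image (· + z))) :=
    ⟨FE ∪ (box d R).sym2, by rw [Finset.coe_union]; exact (hFE.mono Set.subset_union_left).inter ((hdet _).mono Set.subset_union_right)⟩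
  have hloc₂ : IsLocalEvent (E ∩ Hof (P.image (· + z)) ∩ Hof (B.image (· + z))) :=
    ⟨FE ∪ (box d R).sym2, by
      rw [Finset.coe_union]
      exact ((hFE.mono Set.subset_union_left).inter ((hdet _).mono Set.subset_union_right)).inter ((hdet _).mono Set.subset_union_right)⟩
  have hlim₁ := tendsto_iicMeasure_of_isLocalEvent p hν hloc₁
  have hlim₂ := tendsto_iicMeasure_of_isLocalEvent p hν hloc₂
  have hfin := le_of_tendsto_of_tendsto' (hlim₁.const_mul (cU * PV)) hlim₂ fun N => by
    rw [← mul_div_assoc]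
    exact div_le_div_of_nonneg_right (hstep N) (hπ N).le
  rw [hHof_eq, hHof_eq] at hfin
  simpa only [Set.inter_assoc] using hfin

end Summit.CriticalPhenomena.PercolationContinuityZ3.Theorems.Crossing

end
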